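import Summits.NavierStokesRegularity.NavierStokesRegularity.Theses.HodographBetchov
import Literature.Analysis.FluidPDE.LerayGaugeStrainSpectrum

/-!
# `FastClassSqueeze` (stmt-NavierStokesRegularity-15832) follows from a DIRECTIONAL squeeze

Route `HodographBetchov`, crux 3; idea card `Cruxes/FastClassSqueeze/Ideas/vortex-line-derivative.md`
(crux-ideate r1 k2), its first lemma `MiddleEigLeStrainOnDirection` and its transfer
`DirectionalSqueezeTransfer`, PROVED.

* `abs_mid_le_of_sum_eq_zero`: for reals `a ≥ b ≥ c` with `a + b + c = 0`, `|b| ≤ |a|` and `|b| ≤ |c|`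
  — the middle eigenvalue of a trace-free symmetric operator is the SMALLEST in modulus.
* `sq_eigenvalues_mid_le_norm_sq_apply`: for a symmetric `T` on `ℝ³` with `tr T = 0` and its sorted
  eigenvalues `μ₀ ≥ μ₁ ≥ μ₂`, `μ₁² ‖ξ‖² ≤ ‖T ξ‖²` for every `ξ` (Parseval in the eigenbasis).
* `plane_form_le_norm_strain_apply` (= `MiddleEigLeStrainOnDirection`): for a continuous linear map `A`
  of `ℝ³` with `tr A = 0` and a unit vector `ξ`, the min–max clause of the crux holds with the majorant
  `‖S ξ‖`, `S = ½(A + A†)`: `λ₂(S) ≤ |λ₂(S)| = σ_min(S) ≤ ‖S ξ‖` and Courant–Fischer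
  (`strainEigenvalues_mid_le_iff`).
* `fastClassSqueeze_of_directionalSqueeze` (= `DirectionalSqueezeTransfer`): if along every classical
  Leray–Hopf solution from a rapidly decaying datum on `[0,T)` some level `l > 0`, exponent `q > 3/2` and
  UNIT direction field `Ξ(t,x)` make `‖S(t,x) Ξ(t,x)‖ 1_{|u|>l}` Miller-finite, then `FastClassSqueeze`
  holds with `m := ‖S Ξ‖` (trace-freeness from `div u = 0`, `IsClassicalNSSolutionOn.divFree`).  With
  `Ξ = ω̂` this is the card's "velocity varies Miller-integrably along the vortex lines threading fast
  fluid"; the transfer uses only incompressibility, so (by the Negative lemma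
  `fastClassSqueeze_false_without_lerayHopf`) the energy class must enter inside any proof of the
  directional statement itself.
-/

noncomputable section

-- the summit and its single problem share the name `NavierStokesRegularity` (D-0017 nested layout)
set_option linter.dupNamespace false

namespace Summit.NavierStokesRegularity.NavierStokesRegularity.Theorems.FastClassSqueeze.Directional

open Set MeasureTheory Filter Topology Literature.Analysis.FluidPDE Module
open scoped ENNReal NNReal RealInnerProductSpace

/-- **Three reals: the middle one of a zero-sum ordered triple is the smallest in modulus.** If
`a ≥ b ≥ c` and `a + b + c = 0` then `|b| ≤ |a|` and `|b| ≤ |c|` (`a ≥ 0 ≥ c` forces `−a ≤ b ≤ −c`).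
[folklore] -/
theorem abs_mid_le_of_sum_eq_zero {a b c : ℝ} (hab : b ≤ a) (hbc : c ≤ b) (h : a + b + c = 0) :
    |b| ≤ |a| ∧ |b| ≤ |c| := by
  have ha : 0 ≤ a := by linarith
  have hc : c ≤ 0 := by linarith
  refine ⟨abs_le_abs hab (by linarith), ?_⟩
  rw [abs_of_nonpos hc]
  exact abs_le.2 ⟨by linarith, by linarith⟩

/-- **Parseval in the eigenbasis.** For a symmetric operator `T` of a finite-dimensional real inner
product space with sorted eigenvalues `μᵢ` and orthonormal eigenbasis `bᵢ`,
`‖T ξ‖² = ∑ᵢ (μᵢ ⟪bᵢ, ξ⟫)²`. [folklore] -/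
theorem norm_sq_apply_eq_sum {V : Type*} [NormedAddCommGroup V] [InnerProductSpace ℝ V]
    [FiniteDimensional ℝ V] {T : V →ₗ[ℝ] V} (hT : T.IsSymmetric) {n : ℕ} (hn : finrank ℝ V = n)
    (ξ : V) :
    ‖T ξ‖ ^ 2 = ∑ i, (hT.eigenvalues hn i * ⟪hT.eigenvectorBasis hn i, ξ⟫) ^ 2 := by
  rw [← (hT.eigenvectorBasis hn).sum_sq_norm_inner_right (T ξ)]
  refine Finset.sum_congr rfl fun i _ => ?_
  rw [← OrthonormalBasis.repr_apply_apply, hT.eigenvectorBasis_apply_self_apply,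
    OrthonormalBasis.repr_apply_apply, Real.norm_eq_abs, sq_abs]
  rfl

/-- **The middle eigenvalue of a trace-free symmetric operator of `ℝ³` is dominated by `‖T ξ‖ / ‖ξ‖`.**
For symmetric `T` on a `3`-dimensional real inner product space with `tr T = 0` and sorted eigenvalues
`μ₀ ≥ μ₁ ≥ μ₂`: `μ₁² ‖ξ‖² ≤ ‖T ξ‖²` for every `ξ` (`|μ₁| = minᵢ |μᵢ|` by `abs_mid_le_of_sum_eq_zero`,
`∑ μᵢ = tr T = 0`, and Parseval). [cite: HornJohnson2013, Thm 4.2.2] -/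
theorem sq_eigenvalues_mid_le_norm_sq_apply {V : Type*} [NormedAddCommGroup V]
    [InnerProductSpace ℝ V] [FiniteDimensional ℝ V] {T : V →ₗ[ℝ] V} (hT : T.IsSymmetric)
    (h3 : finrank ℝ V = 3) (htr : LinearMap.trace ℝ V T = 0) (ξ : V) :
    hT.eigenvalues h3 1 ^ 2 * ‖ξ‖ ^ 2 ≤ ‖T ξ‖ ^ 2 := by
  set μ := hT.eigenvalues h3 with hμ
  set b := hT.eigenvectorBasis h3 with hb
  -- `μ₀ + μ₁ + μ₂ = 0`
  have hsum : μ 0 + μ 1 + μ 2 = 0 := by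
    have h := hT.trace_eq_sum_eigenvalues h3
    rw [htr, Fin.sum_univ_three] at h
    have h' : ((μ 0 + μ 1 + μ 2 : ℝ) : ℝ) = 0 := by exact_mod_cast h.symm
    exact h'
  -- `|μ₁| ≤ |μᵢ|` for every `i`
  have h10 : μ 1 ≤ μ 0 := hT.eigenvalues_antitone h3 (by decide : (0 : Fin 3) ≤ 1)
  have h21 : μ 2 ≤ μ 1 := hT.eigenvalues_antitone h3 (by decide : (1 : Fin 3) ≤ 2)
  obtain ⟨hA0, hA2⟩ := abs_mid_le_of_sum_eq_zero h10 h21 hsum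
  have hmin : ∀ i : Fin 3, |μ 1| ≤ |μ i| := by
    intro i
    fin_cases i
    · exact hA0
    · exact le_rfl
    · exact hA2
  -- Parseval
  rw [norm_sq_apply_eq_sum hT h3 ξ, ← b.sum_sq_norm_inner_right ξ, Finset.mul_sum]
  refine Finset.sum_le_sum fun i _ => ?_
  rw [Real.norm_eq_abs, sq_abs, mul_pow]
  have h1 : μ 1 ^ 2 ≤ μ i ^ 2 := sq_le_sq.2 (hmin i)
  exact mul_le_mul_of_nonneg_right h1 (sq_nonneg _)

/-- **The min–max clause with the directional majorant `‖S ξ‖`** (card `vortex-line-derivative`,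
`MiddleEigLeStrainOnDirection`).  For a continuous linear map `A` of `ℝ³` with `tr A = 0` and a unit
vector `ξ`, there is an orthonormal pair `v, w` with
`⟪A(αv + βw), αv + βw⟫ ≤ ‖S ξ‖ (α² + β²)` for all `α, β`, where `S = ½(A + A†)` is the symmetric part:
by Courant–Fischer (`strainEigenvalues_mid_le_iff`) it suffices that `λ₂(S) ≤ ‖S ξ‖`, and
`λ₂(S) ≤ |λ₂(S)| ≤ ‖S ξ‖` because `tr S = tr A = 0` makes the middle eigenvalue the smallest in modulus
(`sq_eigenvalues_mid_le_norm_sq_apply` for `T = A + A† = 2S`). [cite: HornJohnson2013, Thm 4.2.6] -/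
theorem plane_form_le_norm_strain_apply
    (A : EuclideanSpace ℝ (Fin 3) →L[ℝ] EuclideanSpace ℝ (Fin 3))
    (htr : LinearMap.trace ℝ (EuclideanSpace ℝ (Fin 3))
      (A : EuclideanSpace ℝ (Fin 3) →ₗ[ℝ] EuclideanSpace ℝ (Fin 3)) = 0)
    {ξ : EuclideanSpace ℝ (Fin 3)} (hξ : ‖ξ‖ = 1) :
    ∃ v w : EuclideanSpace ℝ (Fin 3), ‖v‖ = 1 ∧ ‖w‖ = 1 ∧ inner ℝ v w = 0 ∧
      ∀ α β : ℝ, inner ℝ (A (α • v + β • w)) (α • v + β • w) ≤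
        ‖((1 / 2 : ℝ) • (A + ContinuousLinearMap.adjoint A)) ξ‖ * (α ^ 2 + β ^ 2) := by
  set T : EuclideanSpace ℝ (Fin 3) →ₗ[ℝ] EuclideanSpace ℝ (Fin 3) :=
    addAdjoint (A : EuclideanSpace ℝ (Fin 3) →ₗ[ℝ] EuclideanSpace ℝ (Fin 3)) with hTdef
  have hT : T.IsSymmetric := isSymmetric_addAdjoint _
  have h3 : finrank ℝ (EuclideanSpace ℝ (Fin 3)) = 3 := finrank_euclideanSpace_fin
  -- `tr T = 2 tr A = 0`
  have htrT : LinearMap.trace ℝ _ T = 0 := by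
    set b := stdOrthonormalBasis ℝ (EuclideanSpace ℝ (Fin 3)) with hb
    have h1 : ∀ i, ⟪b i, T (b i)⟫ = 2 * ⟪b i, A (b i)⟫ := by
      intro i
      rw [hTdef, addAdjoint_apply, inner_add_right, LinearMap.adjoint_inner_right]
      simp only [ContinuousLinearMap.coe_coe]
      rw [real_inner_comm (b i) (A (b i))]
      ring
    rw [LinearMap.trace_eq_sum_inner T b, Finset.sum_congr rfl fun i _ => h1 i, ← Finset.mul_sum]
    have h2 : ∑ i, ⟪b i, A (b i)⟫ = LinearMap.trace ℝ _
        (A : EuclideanSpace ℝ (Fin 3) →ₗ[ℝ] EuclideanSpace ℝ (Fin 3)) := by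
      rw [LinearMap.trace_eq_sum_inner _ b]
      simp only [ContinuousLinearMap.coe_coe]
    rw [h2, htr, mul_zero]
  -- the CLM adjoint and the linear-map adjoint agree, so `S ξ = ½ T ξ`
  have hadj : (ContinuousLinearMap.adjoint A) ξ =
      LinearMap.adjoint (A : EuclideanSpace ℝ (Fin 3) →ₗ[ℝ] EuclideanSpace ℝ (Fin 3)) ξ := by
    refine ext_inner_right ℝ fun y => ?_
    rw [ContinuousLinearMap.adjoint_inner_left, LinearMap.adjoint_inner_left]
    rfl
  have hS : ((1 / 2 : ℝ) • (A + ContinuousLinearMap.adjoint A)) ξ = (1 / 2 : ℝ) • T ξ := by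
    rw [smul_apply, add_apply, hadj, hTdef, addAdjoint_apply]
    rfl
  -- `λ₂(S) = ½ μ₁ ≤ ½ |μ₁| ≤ ½ ‖T ξ‖ = ‖S ξ‖`
  have hsq := sq_eigenvalues_mid_le_norm_sq_apply hT h3 htrT ξ
  rw [hξ, one_pow, mul_one] at hsq
  have habs : |hT.eigenvalues h3 1| ≤ ‖T ξ‖ := by
    have := sq_le_sq.1 hsq
    rwa [abs_norm] at this
  have hle : strainEigenvalues (A : EuclideanSpace ℝ (Fin 3) →ₗ[ℝ] EuclideanSpace ℝ (Fin 3)) h3 1 ≤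
      ‖((1 / 2 : ℝ) • (A + ContinuousLinearMap.adjoint A)) ξ‖ := by
    rw [strainEigenvalues_def, hS, norm_smul, Real.norm_eq_abs, abs_of_pos (by norm_num : (0:ℝ) < 1 / 2)]
    have h4 : (isSymmetric_addAdjoint (A : EuclideanSpace ℝ (Fin 3) →ₗ[ℝ] EuclideanSpace ℝ (Fin 3))).eigenvalues
        h3 1 ≤ ‖T ξ‖ := (le_abs_self _).trans habs
    linarith
  obtain ⟨v, w, hv, hw, hvw, h⟩ := (strainEigenvalues_mid_le_iff _ h3 _).1 hle
  refine ⟨v, w, hv, hw, hvw, fun α β => ?_⟩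
  simpa only [ContinuousLinearMap.coe_coe] using h α β

/-- **`FastClassSqueeze` from a directional squeeze** (card `vortex-line-derivative`,
`DirectionalSqueezeTransfer`).  If along every classical solution of unforced Navier–Stokes on
`ℝ³ × [0,T)` that is Leray–Hopf from a rapidly decaying datum there are `l > 0`, `q > 3/2` and a unit
direction field `Ξ(t,x)` with `∫₀ᵀ (∫_{|u(t)|>l} ‖S(t,x) Ξ(t,x)‖^q dx)^{2/(2q−3)} dt < ∞`,
`S = ½(∇u + ∇uᵀ)`, then `FastClassSqueeze` holds with `m := ‖S Ξ‖`: the min–max clause is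
`plane_form_le_norm_strain_apply`, incompressibility (`IsClassicalNSSolutionOn.divFree`, i.e.
`tr ∇u(t,x) = 0`) being the only property of the solution used. [cite: Miller2019, Thm 1.1] -/
theorem fastClassSqueeze_of_directionalSqueeze :
    (∀ (ν T : ℝ), 0 < ν → 0 < T →
      ∀ (u : ℝ → EuclideanSpace ℝ (Fin 3) → EuclideanSpace ℝ (Fin 3))
        (p : ℝ → EuclideanSpace ℝ (Fin 3) → ℝ),
        Literature.Analysis.FluidPDE.IsClassicalNSSolutionOn (Set.Ico 0 T) ν 0 u p →
        Literature.Analysis.FluidPDE.IsLerayHopfOn T ν 0 (u 0) u →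
        Literature.Analysis.FluidPDE.HasRapidSpatialDecay (u 0) →
        ∃ l : ℝ, 0 < l ∧ ∃ q : ℝ, 3 / 2 < q ∧
          ∃ Ξ : ℝ → EuclideanSpace ℝ (Fin 3) → EuclideanSpace ℝ (Fin 3), (∀ t x, ‖Ξ t x‖ = 1) ∧
          ∫⁻ t in Set.Ioo 0 T, (∫⁻ x in {x : EuclideanSpace ℝ (Fin 3) | l < ‖u t x‖},
            ENNReal.ofReal ‖((1 / 2 : ℝ) • (fderiv ℝ (u t) x +
              ContinuousLinearMap.adjoint (fderiv ℝ (u t) x))) (Ξ t x)‖ ^ q) ^ (2 / (2 * q - 3)) < ⊤) →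
    Summit.NavierStokesRegularity.NavierStokesRegularity.Theses.HodographBetchov.FastClassSqueeze := by
  intro hdir ν T hν hT u p hcl hLH hdec
  obtain ⟨l, hl, q, hq, Ξ, hΞ, hint⟩ := hdir ν T hν hT u p hcl hLH hdec
  refine ⟨l, hl, q, hq, fun t x => ‖((1 / 2 : ℝ) • (fderiv ℝ (u t) x +
      ContinuousLinearMap.adjoint (fderiv ℝ (u t) x))) (Ξ t x)‖, fun t x => norm_nonneg _, ?_, hint⟩
  intro t ht x _
  have htr : LinearMap.trace ℝ (EuclideanSpace ℝ (Fin 3))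
      (fderiv ℝ (u t) x : EuclideanSpace ℝ (Fin 3) →ₗ[ℝ] EuclideanSpace ℝ (Fin 3)) = 0 :=
    hcl.divFree t ht x
  exact plane_form_le_norm_strain_apply (fderiv ℝ (u t) x) htr (hΞ t x)

end Summit.NavierStokesRegularity.NavierStokesRegularity.Theorems.FastClassSqueeze.Directional

end
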